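import Summits.ResolutionOfSingularities.ResolutionOfSingularities.Theses.PAlteration
import Literature.AlgebraicGeometry.Resolution.AlterationsPurelyInseparable
import Literature.AlgebraicGeometry.Resolution.StrictNormalCrossings
import Mathlib.AlgebraicGeometry.Morphisms.Smooth
import Mathlib.AlgebraicGeometry.Morphisms.Etale
import HarnessLib

/-!
# Line `bundle-induction` (crux stmt-ResolutionOfSingularities-0555 `Pialt`): PLAN / SCAFFOLD for the lever
# `stub_parameterChange` (strategist s2)

The registered stub `stub_parameterChange p hp n : ParameterChange p n` (stability of the bundle-cover normal form under purely
inseparable regular alteration of the parameter space) assembled SORRY-FREE from three helper lemmas, two of which are proved here: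

* `exists_section_pullback` (PROVED): the pulled-back bundle `B'' := B ×_{H'} H''` with `q''` proper and smooth of relative
  dimension 1 (base change) and the section `σ''` = the lift of `(α ≫ σ, 𝟙)`;
* `range_section_pullback` (PROVED): `range σ'' = b'⁻¹(range σ)` (points of the fibre product over the section come from
  `H' ×_B B''`, which maps to `H''`; the comparison map to the topological fibre product is surjective);
* `exists_cover_pullback` (SORRY — the L-sized scheme-theoretic content, for a stub-worker): the normalised dominant component
  `X''` of `X ×_B B''` — the tensor product of the function fields of `X` and `B''` over that of `B` is a field (separable ⊗
  purely inseparable), so ONE component dominates `B''`; its normalisation is finite over `B''` (finite type over a field),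
  étale — hence equal to the fibre product and regular — off `σ''` (base change of `Etale`, `etale_isStableUnderBaseChange`),
  surjective (finite dominant); `π : X'' → X` is proper (finite ∘ closed immersion ∘ base change of the proper `α`), dominant,
  and finite + universally injective over the preimage of `q⁻¹U ∖ σ(H')` where `α` is finite radicial over `U` (base change,
  Stacks 01S4) — a purely inseparable alteration; the `Z`-clause by `hrange` and `f'' ≫ b' = π ≫ f`;
* dimension: `topologicalKrullDim H'' = topologicalKrullDim H'` (`IsPurelyInseparableAlteration.topologicalKrullDim_eq`).
-/

set_option linter.dupNamespace false
set_option linter.unusedVariables false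

noncomputable section

open CategoryTheory CategoryTheory.Limits AlgebraicGeometry TopologicalSpace
open Literature.AlgebraicGeometry.Resolution

namespace Summit.ResolutionOfSingularities.ResolutionOfSingularities.Theorems.Pialt.BundleInduction

/-- H1a. The pulled-back bundle and its section. [folklore] -/
theorem exists_section_pullback {H' H'' B : Scheme.{0}} (q : B ⟶ H') (σ : H' ⟶ B) (hσ : σ ≫ q = 𝟙 H')
    (α : H'' ⟶ H') [IsProper q] [SmoothOfRelativeDimension 1 q] :
    ∃ (σ'' : H'' ⟶ pullback q α), σ'' ≫ pullback.snd q α = 𝟙 H'' ∧ σ'' ≫ pullback.fst q α = α ≫ σ ∧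
      IsProper (pullback.snd q α) ∧ SmoothOfRelativeDimension 1 (pullback.snd q α) := by
  refine ⟨pullback.lift (α ≫ σ) (𝟙 H'') (by simp [Category.assoc, hσ]), pullback.lift_snd _ _ _,
    pullback.lift_fst _ _ _, inferInstance, ?_⟩
  haveI := smoothOfRelativeDimension_isStableUnderBaseChange (n := 1)
  exact MorphismProperty.pullback_snd (P := @SmoothOfRelativeDimension 1) q α inferInstance

/-- H1b. Points of `B'' = B ×_{H'} H''` over the section `σ(H')` are exactly the points of the pulled-back section:
`range σ'' = fst⁻¹(range σ)`. [folklore] -/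
theorem range_section_pullback {H' H'' B : Scheme.{0}} (q : B ⟶ H') (σ : H' ⟶ B) (hσ : σ ≫ q = 𝟙 H')
    (α : H'' ⟶ H') (σ'' : H'' ⟶ pullback q α) (h₁ : σ'' ≫ pullback.snd q α = 𝟙 H'')
    (h₂ : σ'' ≫ pullback.fst q α = α ≫ σ) :
    Set.range σ''.base = (pullback.fst q α).base ⁻¹' Set.range σ.base := by
  ext y
  constructor
  · rintro ⟨h, rfl⟩
    refine ⟨α.base h, ?_⟩
    rw [← Scheme.Hom.comp_apply, ← Scheme.Hom.comp_apply, h₂]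
  · rintro ⟨h', hh'⟩
    -- `y` lies over `σ h'`; the point `(h', y)` of the topological fibre product lifts to the scheme fibre product
    obtain ⟨z, hz₁, hz₂⟩ := Scheme.Pullback.exists_preimage_pullback (f := σ) (g := pullback.fst q α) h' y hh'
    -- the second projection of `H' ×_B (B ×_{H'} H'')` factors through `σ''`
    have key : pullback.snd σ (pullback.fst q α) =
        (pullback.snd σ (pullback.fst q α) ≫ pullback.snd q α) ≫ σ'' := by
      apply pullback.hom_ext
      · have e1 : pullback.snd σ (pullback.fst q α) ≫ pullback.fst q α =
            pullback.fst σ (pullback.fst q α) ≫ σ := pullback.condition.symm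
        have e2 : (pullback.snd σ (pullback.fst q α) ≫ pullback.snd q α) ≫ α =
            pullback.fst σ (pullback.fst q α) := by
          rw [Category.assoc, ← pullback.condition, ← Category.assoc, e1, Category.assoc, hσ,
            Category.comp_id]
        rw [Category.assoc, h₂, ← Category.assoc, e2, e1]
      · rw [Category.assoc, h₁, Category.comp_id]
    refine ⟨(pullback.snd σ (pullback.fst q α) ≫ pullback.snd q α).base z, ?_⟩
    rw [← Scheme.Hom.comp_apply, ← key]
    exact hz₂

/-- H2 (SORRY, L-sized — the scheme-theoretic content of the lever, for a stub-worker; see the module docstring). [folklore] -/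
theorem exists_cover_pullback (p : ℕ) (hp : p.Prime) (n : ℕ) (k : Type) [Field k] [CharP k p] [PerfectField k]
    (H' : Scheme.{0}) (h' : H' ⟶ Spec (.of k)) [IsProper h'] [IsIntegral H'] (hH' : Scheme.IsRegular H')
    (B : Scheme.{0}) (q : B ⟶ H') (σ : H' ⟶ B) [IsProper q] [SmoothOfRelativeDimension 1 q] (hσ : σ ≫ q = 𝟙 H')
    (X : Scheme.{0}) (f : X ⟶ B) [IsIntegral X] (hXn : ∀ x : X, IsIntegrallyClosed (X.presheaf.stalk x))
    [IsFinite f] (hfs : Function.Surjective f.base)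
    (hét : ∀ U : B.Opens, Disjoint (U : Set B) (Set.range σ.base) → Etale (f ∣_ U))
    (Z : Set X) (hZ : IsClosed Z) (hZσ : f.base '' Z ⊆ Set.range σ.base)
    (H'' : Scheme.{0}) (α : H'' ⟶ H') (hα : IsPurelyInseparableAlteration α) (hH'' : Scheme.IsRegular H'')
    -- the pulled-back bundle with its section (from `exists_section_pullback`)
    (B'' : Scheme.{0}) (b' : B'' ⟶ B) (q'' : B'' ⟶ H'') (hcart : IsPullback b' q'' q α)
    (σ'' : H'' ⟶ B'') (hσ''q : σ'' ≫ q'' = 𝟙 H'') (hσ''b : σ'' ≫ b' = α ≫ σ)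
    (hrange : Set.range σ''.base = b'.base ⁻¹' Set.range σ.base) :
    ∃ (X'' : Scheme.{0}) (f'' : X'' ⟶ B'') (π : X'' ⟶ X),
      IsIntegral X'' ∧ (∀ x : X'', IsIntegrallyClosed (X''.presheaf.stalk x)) ∧ IsFinite f'' ∧
      Function.Surjective f''.base ∧
      (∀ U : B''.Opens, Disjoint (U : Set B'') (Set.range σ''.base) → Etale (f'' ∣_ U)) ∧
      IsPurelyInseparableAlteration π ∧ f'' ≫ b' = π ≫ f ∧
      f''.base '' (π.base ⁻¹' Z) ⊆ Set.range σ''.base := by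
  sorry

/-- ASSEMBLY (sorry-free modulo H2): the registered stub `stub_parameterChange` by name. -/
theorem stub_parameterChange (p : ℕ) (hp : p.Prime) (n : ℕ) : ∀ (k : Type) [Field k] [CharP k p] [PerfectField k] (H' : Scheme.{0}) (h' : H' ⟶ Spec (.of k)), IsProper h' → IsIntegral H' → Scheme.IsRegular H' → topologicalKrullDim H' ≤ ((n : ℕ) : WithBot ℕ∞) → ∀ (B : Scheme.{0}) (q : B ⟶ H') (σ : H' ⟶ B), IsProper q → SmoothOfRelativeDimension 1 q → σ ≫ q = 𝟙 H' → ∀ (X : Scheme.{0}) (f : X ⟶ B), IsIntegral X → (∀ x : X, IsIntegrallyClosed (X.presheaf.stalk x)) → IsFinite f → Function.Surjective f.base → (∀ U : B.Opens, Disjoint (U : Set B) (Set.range σ.base) → Etale (f ∣_ U)) → ∀ Z : Set X, IsClosed Z → f.base '' Z ⊆ Set.range σ.base → ∀ (H'' : Scheme.{0}) (α : H'' ⟶ H'), IsPurelyInseparableAlteration α → Scheme.IsRegular H'' → ∃ (B'' : Scheme.{0}) (q'' : B'' ⟶ H'') (σ'' : H'' ⟶ B'') (X'' : Scheme.{0})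 (f'' : X'' ⟶ B'') (π : X'' ⟶ X), IsProper q'' ∧ SmoothOfRelativeDimension 1 q'' ∧ σ'' ≫ q'' = 𝟙 H'' ∧ IsIntegral X'' ∧ (∀ x : X'', IsIntegrallyClosed (X''.presheaf.stalk x)) ∧ IsFinite f'' ∧ Function.Surjective f''.base ∧ (∀ U : B''.Opens, Disjoint (U : Set B'') (Set.range σ''.base) → Etale (f'' ∣_ U)) ∧ topologicalKrullDim H'' ≤ ((n : ℕ) : WithBot ℕ∞) ∧ IsPurelyInseparableAlteration π ∧ f'' ≫ q'' ≫ α = π ≫ f ≫ q ∧ f''.base '' (π.base ⁻¹' Z) ⊆ Set.range σ''.base := by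
  intro k _ _ _ H' h' hh' hiH' hH' hdim B q σ hq hsm hσ X f hiX hXn hfin hfs hét Z hZ hZσ H'' α hα hH''
  haveI := hh'; haveI := hiH'; haveI := hq; haveI := hsm; haveI := hiX; haveI := hfin
  obtain ⟨σ'', h₁, h₂, hq'', hsm''⟩ := exists_section_pullback q σ hσ α
  have hrange := range_section_pullback q σ hσ α σ'' h₁ h₂
  haveI := hα.isIntegral
  obtain ⟨X'', f'', π, hiX'', hX''n, hfin'', hfs'', hét'', hπ, hcomm, hZ''⟩ :=
    exists_cover_pullback p hp n k H' h' hH' B q σ hσ X f hXn hfs hét Z hZ hZσ H'' α hα hH''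
      (pullback q α) (pullback.fst q α) (pullback.snd q α) (IsPullback.of_hasPullback q α) σ'' h₁ h₂ hrange
  refine ⟨pullback q α, pullback.snd q α, σ'', X'', f'', π, hq'', hsm'', h₁, hiX'', hX''n, hfin'', hfs'', hét'', ?_,
    hπ, ?_, hZ''⟩
  · -- dimension of the parameter space is unchanged by a purely inseparable alteration
    haveI : LocallyOfFiniteType h' := hh'.toLocallyOfFiniteType
    rw [hα.topologicalKrullDim_eq h']
    exact hdim
  · -- `f'' ≫ q'' ≫ α = π ≫ f ≫ q`
    rw [← pullback.condition, ← Category.assoc, hcomm, Category.assoc]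

end Summit.ResolutionOfSingularities.ResolutionOfSingularities.Theorems.Pialt.BundleInduction

end
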